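import Mathlib
import Literature.Analysis.FluidPDE.PoincareBall
import Literature.Analysis.FluidPDE.SuitableWeakRescaling
import Literature.Analysis.FluidPDE.SereginSverakPressureProofs
import Literature.Analysis.FluidPDE.BlowupFarField
import Literature.Analysis.FluidPDE.SereginSverak2002VertexBlowupLimit
import Literature.Analysis.FluidPDE.NSSuitableESS
import Literature.Analysis.FluidPDE.ESSLocalHolderHolds
import Literature.Analysis.FluidPDE.ESSLocalHolderBlowupLimit
import Literature.Analysis.FluidPDE.LocalTypeIScaling
import Literature.Analysis.FluidPDE.LocalTypeIPersistenceHolds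
import Literature.Analysis.FluidPDE.LocalTypeICongr
import Literature.Analysis.FluidPDE.LeraySuitableWeakSolutions
import Literature.Analysis.FluidPDE.NSWeakStrongUniquenessHolds
import Literature.Analysis.FluidPDE.TaoLocalisationHolds
import Literature.Analysis.FluidPDE.TaoLocalisationProofs
import Literature.Analysis.FluidPDE.KatoMaximalTimeSingular
import Literature.Analysis.FluidPDE.TypeIRateScaledEnergyBound
import Literature.Analysis.FluidPDE.SereginSverak2002PressureLowerBoundProofs
import Literature.Analysis.FluidPDE.NSLerayHopfABCScaling
import Literature.Analysis.FluidPDE.NSTimeRescaleClassical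
import Literature.Analysis.FluidPDE.NSViscosityRescaling
import Literature.Analysis.FluidPDE.TypeIAncientMildRescale
import Literature.Analysis.FluidPDE.SelfSimilar
import Literature.Analysis.FluidPDE.AncientAxisymmetricTypeILiouville
import Literature.Analysis.FluidPDE.CKNLocalEnergyEstimate
import Literature.Analysis.FluidPDE.CKNPressureEstimate
import Literature.Analysis.FluidPDE.CKNUnforcedOneScaleRRS
import Literature.Analysis.FluidPDE.CKNLocalRegularityRRSPressure
import Literature.Analysis.FluidPDE.RusinSverakSingularityStabilityEpsilon
import Literature.Analysis.FluidPDE.CKNScalingExtras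
import Literature.Analysis.FluidPDE.CKNLocalRegularityRRSStep3
import Literature.Analysis.FluidPDE.PineauVicolOneSliceProofs
import Literature.Analysis.FluidPDE.TsaiLocalEnergyProofs
import Summits.NavierStokesRegularity.NavierStokesRegularity.Theorems.TypeIQuarterGateScarEnvelopeTypeIRateFloorEngines
import Summits.NavierStokesRegularity.NavierStokesRegularity.Theorems.TypeIQuarterGateScarEnvelopeTypeIRateFloorConstants

/-!
# Rate floor for crux `ScarEnvelopeTypeI` (stmt-NavierStokesRegularity-23843) — Part O5: ★ the floor theorem

Part O5 of the ROUND-35 plate: `floor_shifted` / ★ `floor` — a suitable weak solution on `Q_a(0)` with `A, E ≤ I` on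
sub-balls, `P ∈ L^{3/2}`, and the pointwise Type-I rate `√(-t)‖U‖ ≤ ε ≤ ε_*(I)` on `(-δ², 0) × B_δ(y')` is REGULAR at
`(0, y')` (`‖U‖ ≤ K` a.e. on a final-time cylinder about `(0, y')`): O1 at the shifted centres `(-h, y')`, the scheme O3
with the constants O4, the tree's backward ε-regularity criterion, and a countable union at the vertex.

PROVENANCE: declaration texts VERBATIM from the HOME plate of the instrument seat nsreg-p3 g26 (cell
`pub/ns-regularity-ideate`): `round-35/Tangent35prep.lean` v9 (sha16 `ce6f8ea4cb093fca`; = ROUND-34 plate v8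
`84f56c3bc8f4da24` VERBATIM + Part O), scored PASS by referee ref3 g26 (`SCORE-p3-ROUND-35-0828.md`); the author cannot
write under `Theorems/` (`perm.theorems-prover-only`); landed by the prover ns-es-p1 g5 as landing hand of record
(director-ns DIRECTOR-NS #237 (3)), split into ≤ 400-line modules, namespace
`Summit.NavierStokesRegularity.NavierStokesRegularity.Cruxes.ScarEnvelopeTypeI.ZoomDictionary.Floor` for the plate's `NsregP3.R35O` (and `Summit.NavierStokesRegularity.NavierStokesRegularity.Cruxes.ScarEnvelopeTypeI.ZoomDictionary`
for its `NsregP3.R30P`, as in the 26 landed dictionary / satellite-tower modules), `E3` spelled out, one-line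
docstrings added where the plate had none.  `--supports stmt-NavierStokesRegularity-23843 --as helper`.

HONEST FRAMING: an effective ε-regularity INSTRUMENT inside the Type-I box, proved from the tree's CKN engines
(`localEnergy_master`, `pressureEstimate_holds`, `RRS2016.theorem15_3_holds`) — no compactness, no Liouville theorem,
no hypothesis taken from print; it bears on the crux `TypeIQuarterGate.ScarEnvelopeTypeI` (item 23843) only through the
satellite-tower census (Part N's `SmallRateRegularity` hypothesis is discharged on bounded sub-classes).  NO open
statement is proved — 23843, its parent `QuarterLawTypeI`, the route and Navier–Stokes regularity are OPEN.
-/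

-- the summit-side namespace repeats a component by design (single-conjunct summit, D-0017)
set_option linter.dupNamespace false

open MeasureTheory Set Metric Filter Topology
open scoped ENNReal NNReal InnerProductSpace
open Literature.Analysis.FluidPDE

namespace Summit.NavierStokesRegularity.NavierStokesRegularity.Cruxes.ScarEnvelopeTypeI.ZoomDictionary.Floor

/-! ## O5. The floor theorem at a shifted centre, and at the final-time point -/

/-- Closure of a small cylinder at the shifted centre `(-h, y')` inside the big open ball `Q_a(0)`. -/
theorem closure_cyl_subset {a h r : ℝ} {y' : (EuclideanSpace ℝ (Fin 3))} (ha : ‖y'‖ + 2 ≤ a) (hh : 0 < h) (hh1 : h ≤ 1)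
    (hr : 0 < r) (hr1 : r ≤ 1) :
    closure (parabolicCylinder r (((-h : ℝ), y') : ℝ × (EuclideanSpace ℝ (Fin 3)))) ⊆
      ((parabolicCylinderOpens a (0 : ℝ × (EuclideanSpace ℝ (Fin 3))) : TopologicalSpace.Opens (ℝ × (EuclideanSpace ℝ (Fin 3)))) : Set (ℝ × (EuclideanSpace ℝ (Fin 3)))) := by
  rw [coe_parabolicCylinderOpens, parabolicCylinder, closure_prod_eq,
    closure_Ioo (by nlinarith : (-h : ℝ) - r ^ 2 ≠ -h), closure_ball _ hr.ne']
  intro w hw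
  rw [mem_prod, mem_Icc, mem_closedBall] at hw
  rw [mem_parabolicCylinder]
  have hn : 0 ≤ ‖y'‖ := norm_nonneg _
  have ha2 : 2 ≤ a := by linarith
  refine ⟨⟨?_, ?_⟩, ?_⟩
  · have : (0 : ℝ × (EuclideanSpace ℝ (Fin 3))).1 - a ^ 2 ≤ -4 := by simp; nlinarith
    linarith [hw.1.1, sq_nonneg r, show r ^ 2 ≤ 1 by nlinarith]
  · have : (0 : ℝ × (EuclideanSpace ℝ (Fin 3))).1 = 0 := rfl
    linarith [hw.1.2]
  · have h0 : (0 : ℝ × (EuclideanSpace ℝ (Fin 3))).2 = 0 := rfl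
    rw [h0, dist_zero_right]
    calc ‖w.2‖ = dist w.2 0 := (dist_zero_right _).symm
      _ ≤ dist w.2 y' + dist y' 0 := dist_triangle _ _ _
      _ ≤ r + ‖y'‖ := by rw [dist_zero_right]; linarith [hw.2]
      _ < a := by linarith

/-- Same centre, smaller radius. -/
theorem cyl_mono {r R : ℝ} (h : r ≤ R) (hr : 0 ≤ r) (z : ℝ × (EuclideanSpace ℝ (Fin 3))) :
    parabolicCylinder r z ⊆ parabolicCylinder R z := by
  intro w hw
  rw [mem_parabolicCylinder] at hw ⊢
  refine ⟨⟨?_, hw.1.2⟩, hw.2.trans_le h⟩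
  nlinarith [hw.1.1]

/-- **O5a (floor at a shifted centre).**  See `floor` for the hypotheses; here the centre is
`(-h, y')` with `0 < h ≤ δ²/4` and the conclusion is the a.e. bound on `Q_{ρ/2}((-h, y'))` with
`ρ = θ₀^{k₁+1+k₂} δ/2` and constant `C₀ ε₀ / ρ`, both uniform in `h`. -/
theorem floor_shifted {I ε δ a h : ℝ} {U : ℝ → (EuclideanSpace ℝ (Fin 3)) → (EuclideanSpace ℝ (Fin 3))} {P : ℝ → (EuclideanSpace ℝ (Fin 3)) → ℝ}
    {H : ℝ → (EuclideanSpace ℝ (Fin 3)) → (EuclideanSpace ℝ (Fin 3)) →L[ℝ] (EuclideanSpace ℝ (Fin 3))} {y' : (EuclideanSpace ℝ (Fin 3))}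
    (hδ : 0 < δ) (hδ1 : δ ≤ 1) (ha : ‖y'‖ + 2 ≤ a)
    (hsuit : IsSuitableWeakSolutionOn (parabolicCylinderOpens a (0 : ℝ × (EuclideanSpace ℝ (Fin 3)))) 1 0 U P)
    (hH : HasWeakSpatialGradientOn (parabolicCylinderOpens a (0 : ℝ × (EuclideanSpace ℝ (Fin 3)))) U H)
    (hA : ∀ r > 0, ∀ z, parabolicCylinder r z ⊆ parabolicCylinder a (0 : ℝ × (EuclideanSpace ℝ (Fin 3))) →
      cknAEss r z U ≤ ENNReal.ofReal I)
    (hE : ∀ r > 0, ∀ z, parabolicCylinder r z ⊆ parabolicCylinder a (0 : ℝ × (EuclideanSpace ℝ (Fin 3))) →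
      cknE r z H ≤ ENNReal.ofReal I)
    (hDfin : ∫⁻ w in parabolicCylinder a (0 : ℝ × (EuclideanSpace ℝ (Fin 3))), ‖P w.1 w.2‖ₑ ^ (3 / 2 : ℝ) ≠ ⊤)
    (hrate : ∀ t ∈ Ioo (-δ ^ 2) 0, ∀ x ∈ ball y' δ, Real.sqrt (-t) * ‖U t x‖ ≤ ε)
    (hε0 : 0 ≤ ε) (hε : ε ≤ epsFloor I)
    {k₁ : ℕ} (hk₁ : ((ENNReal.ofReal (δ / 2) ^ 2)⁻¹ *
      ∫⁻ w in parabolicCylinder a (0 : ℝ × (EuclideanSpace ℝ (Fin 3))), ‖P w.1 w.2‖ₑ ^ (3 / 2 : ℝ)).toReal ≤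
        2 ^ k₁ * (b₁ * (max I 1) ^ (3 / 2 : ℝ)))
    {k₂ : ℕ} (hk₂ : 3 * b₁ * (max I 1) ^ (3 / 2 : ℝ) ≤ 2 ^ k₂ * (τ₀ / 3))
    (hh : 0 < h) (hh' : h ≤ δ ^ 2 / 4) :
    ∀ᵐ w ∂(volume.restrict (parabolicCylinder (θ₀ ^ (k₁ + 1 + k₂) * (δ / 2) / 2)
      (((-h : ℝ), y') : ℝ × (EuclideanSpace ℝ (Fin 3))))), ‖U w.1 w.2‖ ≤ C₀ * ε₀ / (θ₀ ^ (k₁ + 1 + k₂) * (δ / 2)) := by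
  -- constants and boxes
  set J := max I 1 with hJdef
  have hJ1 : 1 ≤ J := le_max_right _ _
  have hIJ : I ≤ J := le_max_left _ _
  have hJ0 : 0 < J := by linarith
  obtain ⟨hε1, hεI, hεK⟩ := epsFloor_spec hε0 hε
  have hθ := θ₀_pos; have hθ' := θ₀_le_half; have hθ1 := θ₀_lt_one
  set Q : TopologicalSpace.Opens (ℝ × (EuclideanSpace ℝ (Fin 3))) := parabolicCylinderOpens a (0 : ℝ × (EuclideanSpace ℝ (Fin 3))) with hQdef
  have hmeas : AEStronglyMeasurable (Function.uncurry U)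
      (volume.restrict (parabolicCylinder a (0 : ℝ × (EuclideanSpace ℝ (Fin 3))))) := hH.locallyIntegrableOn.aestronglyMeasurable
  -- the centre and the scales
  set z : ℝ × (EuclideanSpace ℝ (Fin 3)) := ((-h : ℝ), y') with hzdef
  have hz1 : z.1 = -h := rfl
  have hz2 : z.2 = y' := rfl
  have hh1 : h ≤ 1 := by nlinarith
  set r₀ : ℝ := δ / 2 with hr₀
  have hr₀pos : 0 < r₀ := by positivity
  have hr₀1 : r₀ ≤ 1 / 2 := by rw [hr₀]; linarith
  set rk : ℕ → ℝ := fun k => θ₀ ^ k * r₀ with hrkdef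
  have hrkpos : ∀ k, 0 < rk k := fun k => by positivity
  have hrk_le : ∀ k, rk k ≤ r₀ := fun k => by
    have : θ₀ ^ k ≤ 1 := pow_le_one₀ hθ.le hθ1.le
    calc rk k = θ₀ ^ k * r₀ := rfl
      _ ≤ 1 * r₀ := by gcongr
      _ = r₀ := one_mul _
  have hrk1 : ∀ k, rk k ≤ 1 := fun k => (hrk_le k).trans (by linarith)
  have hrk_succ : ∀ k, θ₀ * rk k = rk (k + 1) := fun k => by
    simp only [hrkdef, pow_succ]; ring
  have hrk0 : rk 0 = r₀ := by simp [hrkdef]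
  -- geometry
  have hcl : ∀ k, closure (parabolicCylinder (rk k) z) ⊆ (Q : Set (ℝ × (EuclideanSpace ℝ (Fin 3)))) := fun k =>
    closure_cyl_subset ha hh hh1 (hrkpos k) (hrk1 k)
  have hQa : ∀ k, parabolicCylinder (rk k) z ⊆ parabolicCylinder a (0 : ℝ × (EuclideanSpace ℝ (Fin 3))) := fun k =>
    subset_closure.trans (hcl k)
  have hrate_k : ∀ k, ∀ t ∈ Ioo (z.1 - rk k ^ 2) z.1, ∀ x ∈ ball z.2 (rk k),
      Real.sqrt (-t) * ‖U t x‖ ≤ ε := by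
    intro k t ht x hx
    rw [hz1] at ht
    rw [hz2] at hx
    have hrk2 : rk k ^ 2 ≤ δ ^ 2 / 4 := by
      have := hrk_le k; rw [hr₀] at this
      have h0 := (hrkpos k).le
      nlinarith
    refine hrate t ⟨by nlinarith [ht.1], by linarith [ht.2]⟩ x (ball_subset_ball ?_ hx)
    exact (hrk_le k).trans (by rw [hr₀]; linarith)
  -- the ENNReal quantities: bounds and finiteness
  have hAk : ∀ k, cknAEss (rk k) z U ≤ ENNReal.ofReal J := fun k =>
    (hA _ (hrkpos k) z (hQa k)).trans (ENNReal.ofReal_le_ofReal hIJ)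
  have hEk : ∀ k, cknE (rk k) z H ≤ ENNReal.ofReal J := fun k =>
    (hE _ (hrkpos k) z (hQa k)).trans (ENNReal.ofReal_le_ofReal hIJ)
  have hCk : ∀ k, cknC (rk k) z U ≤ ENNReal.ofReal (2 * ε * J) := fun k => by
    have h1 := cknC_le_of_rate (hrkpos k) hε0 (by rw [hz1]; linarith)
      (hmeas.mono_measure (Measure.restrict_mono (hQa k) le_rfl)) (hrate_k k)
    refine h1.trans ?_
    calc ENNReal.ofReal (2 * ε) * cknAEss (rk k) z U
        ≤ ENNReal.ofReal (2 * ε) * ENNReal.ofReal J := mul_le_mul' le_rfl (hAk k)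
      _ = ENNReal.ofReal (2 * ε * J) := by rw [← ENNReal.ofReal_mul (by positivity)]
  have hAfin : ∀ k, cknAEss (rk k) z U ≠ ⊤ := fun k => ne_top_of_le_ne_top ENNReal.ofReal_ne_top (hAk k)
  have hEfin : ∀ k, cknE (rk k) z H ≠ ⊤ := fun k => ne_top_of_le_ne_top ENNReal.ofReal_ne_top (hEk k)
  have hCfin : ∀ k, cknC (rk k) z U ≠ ⊤ := fun k => ne_top_of_le_ne_top ENNReal.ofReal_ne_top (hCk k)
  have hDbd : ∀ k, cknD (rk k) z P ≤ (ENNReal.ofReal (rk k) ^ 2)⁻¹ *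
      ∫⁻ w in parabolicCylinder a (0 : ℝ × (EuclideanSpace ℝ (Fin 3))), ‖P w.1 w.2‖ₑ ^ (3 / 2 : ℝ) := fun k => by
    rw [cknD]
    exact mul_le_mul' le_rfl (lintegral_mono_set (hQa k))
  have hDfin' : ∀ k, cknD (rk k) z P ≠ ⊤ := fun k =>
    ne_top_of_le_ne_top (ENNReal.mul_ne_top (ENNReal.inv_ne_top.2
      (pow_ne_zero _ (ENNReal.ofReal_pos.2 (hrkpos k)).ne')) hDfin) (hDbd k)
  -- the real sequences
  set A : ℕ → ℝ := fun k => (cknAEss (rk k) z U).toReal with hAdef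
  set Es : ℕ → ℝ := fun k => (cknE (rk k) z H).toReal with hEdef
  set C : ℕ → ℝ := fun k => (cknC (rk k) z U).toReal with hCdef
  set D : ℕ → ℝ := fun k => (cknD (rk k) z P).toReal with hDdef
  have hA' : ∀ k, A k ≤ J := fun k => ENNReal.toReal_le_of_le_ofReal hJ0.le (hAk k)
  have hE' : ∀ k, Es k ≤ J := fun k => ENNReal.toReal_le_of_le_ofReal hJ0.le (hEk k)
  have hC' : ∀ k, C k ≤ 2 * ε * J := fun k => ENNReal.toReal_le_of_le_ofReal (by positivity) (hCk k)
  -- the `E`-step (tree master inequality, rescaled, real form)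
  have stepE : ∀ k, Es (k + 1) ≤ a₁ * C k ^ (2 / 3 : ℝ) +
      a₂ * (A k * Es k) ^ (1 / 2 : ℝ) * C k ^ (1 / 3 : ℝ) + a₃ * D k ^ (2 / 3 : ℝ) * C k ^ (1 / 3 : ℝ) := by
    intro k
    have hm := master Q U P H z (rk k) (hrkpos k) hsuit hH (hcl k) (hAfin k) (hEfin k) (hCfin k)
      (hDfin' k) θ₀ hθ hθ'
    rw [hrk_succ k] at hm
    have hr := real_master cT_pos c1_nonneg C4_nonneg hθ hm (hAfin k) (hEfin k) (hCfin k) (hDfin' k)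
    refine hr.trans (le_of_eq ?_)
    simp only [a₁, a₂, a₃, hAdef, hEdef, hCdef, hDdef]
    ring
  -- the `D`-step (tree pressure estimate, real form, contraction `κ₆ θ₀ ≤ 1/2`)
  have stepD : ∀ k, D (k + 1) ≤ b₁ * A k ^ (3 / 4 : ℝ) * Es k ^ (3 / 4 : ℝ) + D k / 2 := by
    intro k
    have hp := press Q 0 U P H hsuit
      (by
        have : Function.uncurry (0 : ℝ → (EuclideanSpace ℝ (Fin 3)) → (EuclideanSpace ℝ (Fin 3))) = fun _ => 0 := by
          funext w; rfl
        rw [this]; exact locallyIntegrableOn_const _)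
      (fun φ _ => by simp) hH z (rk k) θ₀ (hrkpos k) hθ hθ' (hcl k)
    rw [hrk_succ k] at hp
    obtain ⟨-, hr⟩ := real_pressure' hθ hp (hAfin k) (hEfin k) (hDfin' k)
    have hA0 : 0 ≤ A k := ENNReal.toReal_nonneg
    have hE0 : 0 ≤ Es k := ENNReal.toReal_nonneg
    have hD0 : 0 ≤ D k := ENNReal.toReal_nonneg
    have hAE : 0 ≤ A k ^ (3 / 4 : ℝ) * Es k ^ (3 / 4 : ℝ) :=
      mul_nonneg (Real.rpow_nonneg hA0 _) (Real.rpow_nonneg hE0 _)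
    have h1 : (κ₅ : ℝ) * θ₀ ^ (-(3 / 2 : ℝ)) * A k ^ (3 / 4 : ℝ) * Es k ^ (3 / 4 : ℝ) ≤
        b₁ * A k ^ (3 / 4 : ℝ) * Es k ^ (3 / 4 : ℝ) := by
      have := mul_le_mul_of_nonneg_right κ₅_le_b₁ hAE
      simpa only [mul_assoc] using this
    have h2 : (κ₆ : ℝ) * θ₀ * D k ≤ D k / 2 := by
      have := mul_le_mul_of_nonneg_right κ₆_mul_θ₀_le hD0
      linarith
    calc D (k + 1) = (cknD (rk (k + 1)) z P).toReal := rfl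
      _ ≤ (κ₅ : ℝ) * θ₀ ^ (-(3 / 2 : ℝ)) * A k ^ (3 / 4 : ℝ) * Es k ^ (3 / 4 : ℝ) +
          (κ₆ : ℝ) * θ₀ * D k := hr
      _ ≤ b₁ * A k ^ (3 / 4 : ℝ) * Es k ^ (3 / 4 : ℝ) + D k / 2 := add_le_add h1 h2
  -- start of the `D`-recursion
  have hk₁' : D 0 ≤ 2 ^ k₁ * (b₁ * J ^ (3 / 2 : ℝ)) := by
    refine le_trans ?_ hk₁
    have hb := hDbd 0
    rw [hrk0] at hb
    have hfin : (ENNReal.ofReal (δ / 2) ^ 2)⁻¹ *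
        ∫⁻ w in parabolicCylinder a (0 : ℝ × (EuclideanSpace ℝ (Fin 3))), ‖P w.1 w.2‖ₑ ^ (3 / 2 : ℝ) ≠ ⊤ :=
      ENNReal.mul_ne_top (ENNReal.inv_ne_top.2
        (pow_ne_zero _ (ENNReal.ofReal_pos.2 hr₀pos).ne')) hDfin
    simp only [hDdef, hrk0]
    exact ENNReal.toReal_mono hfin hb
  -- run the scheme
  have hfinal := scheme hJ1 hε0 hε1 a₁_nonneg a₂_nonneg a₃_nonneg b₁_pos.le
    (A := A) (E := Es) (C := C) (D := D)
    (fun _ => ENNReal.toReal_nonneg) (fun _ => ENNReal.toReal_nonneg)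
    (fun _ => ENNReal.toReal_nonneg) (fun _ => ENNReal.toReal_nonneg)
    hA' hE' hC' stepE stepD hk₁' hk₂ hεI (by simpa [K₁] using hεK)
  -- the smallness of `∫∫ (|U|³ + |P|^{3/2})` on `Q_ρ(z)`, `ρ = rk (k₁+1+k₂)`
  set ks := k₁ + 1 + k₂ with hks
  set ρ := rk ks with hρdef
  have hρ : 0 < ρ := hrkpos ks
  have hρ2 : ENNReal.ofReal ρ ^ 2 ≠ 0 := pow_ne_zero _ (ENNReal.ofReal_pos.2 hρ).ne'
  have hρ2' : ENNReal.ofReal ρ ^ 2 ≠ ⊤ := ENNReal.pow_ne_top ENNReal.ofReal_ne_top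
  have hUint : ∫⁻ w in parabolicCylinder ρ z, ‖U w.1 w.2‖ₑ ^ (3 : ℕ) =
      ENNReal.ofReal ρ ^ 2 * cknC ρ z U := by
    rw [cknC, ← mul_assoc, ENNReal.mul_inv_cancel hρ2 hρ2', one_mul]
  have hPint : ∫⁻ w in parabolicCylinder ρ z, ‖P w.1 w.2‖ₑ ^ (3 / 2 : ℝ) =
      ENNReal.ofReal ρ ^ 2 * cknD ρ z P := by
    rw [cknD, ← mul_assoc, ENNReal.mul_inv_cancel hρ2 hρ2', one_mul]
  have hmeasρ : AEMeasurable (fun w : ℝ × (EuclideanSpace ℝ (Fin 3)) => ‖U w.1 w.2‖ₑ ^ (3 : ℕ))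
      (volume.restrict (parabolicCylinder ρ z)) := by
    have : AEMeasurable (fun w : ℝ × (EuclideanSpace ℝ (Fin 3)) => ‖Function.uncurry U w‖ₑ)
        (volume.restrict (parabolicCylinder ρ z)) :=
      (hmeas.mono_measure (Measure.restrict_mono (hQa ks) le_rfl)).aemeasurable.enorm
    exact this.pow_const 3
  have hsmall : ∫⁻ w in parabolicCylinder ρ z, (‖U w.1 w.2‖ₑ ^ (3 : ℕ) + ‖P w.1 w.2‖ₑ ^ (3 / 2 : ℝ)) ≤
      ENNReal.ofReal (ε₀ ^ 3 * ρ ^ 2) := by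
    rw [lintegral_add_left' hmeasρ, hUint, hPint, ← mul_add,
      ← ENNReal.ofReal_toReal (hCfin ks), ← ENNReal.ofReal_toReal (hDfin' ks),
      ← ENNReal.ofReal_add ENNReal.toReal_nonneg ENNReal.toReal_nonneg,
      ← ENNReal.ofReal_pow hρ.le, ← ENNReal.ofReal_mul (by positivity), mul_comm (ε₀ ^ 3)]
    refine ENNReal.ofReal_le_ofReal (mul_le_mul_of_nonneg_left ?_ (by positivity))
    have : C ks + D ks ≤ τ₀ := hfinal
    simpa [τ₀, hCdef, hDdef] using this
  -- Lemarié-Rieusset suitability on `Q_{r₀}(z)` and the one-scale criterion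
  obtain ⟨G', hLR⟩ := hsuit.isLRSuitableWeakSolutionOn_parabolicCylinder hr₀pos
    (by have := hcl 0; rwa [hrk0] at this) 2
  have hsub : parabolicCylinder ρ z ⊆
      ((parabolicCylinderOpens r₀ z : TopologicalSpace.Opens (ℝ × (EuclideanSpace ℝ (Fin 3)))) : Set (ℝ × (EuclideanSpace ℝ (Fin 3)))) := by
    rw [coe_parabolicCylinderOpens]; exact cyl_mono (hrk_le ks) hρ.le z
  have key := reg (parabolicCylinderOpens r₀ z) 2 U P G' (by norm_num) hLR z ρ ε₀ hρ hsub
    ε₀_pos.le le_rfl hsmall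
  simpa [hρdef, hrkdef, hr₀, hks] using key

/-- **O5 ★ (THE FLOOR IS A THEOREM).**  Let `(U, P)` be a suitable weak solution of Navier–Stokes
(`ν = 1`, no force) on the parabolic ball `Q_a(0)`, `a ≥ ‖y'‖ + 2`, with a weak spatial gradient
`H` there, whose Albritton–Barker quantities satisfy `A(Q') ≤ I` and `E(Q') ≤ I` on every
parabolic sub-ball `Q' ⊆ Q_a(0)` (e.g. `𝐈(Q_a(0)) ≤ I`) and `P ∈ L^{3/2}(Q_a(0))`.  If the
velocity obeys the POINTWISE TYPE-I RATE `√(-t) |U(t, x)| ≤ ε` on `(-δ², 0) × B_δ(y')`,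
`0 < δ ≤ 1`, with `ε ≤ ε_*(I) = epsFloor I` (O4, explicit), then `(0, y')` is a REGULAR point:
`|U| ≤ K` a.e. on a final-time cylinder `Q_ρ((0, y'))`. -/
theorem floor {I ε δ a : ℝ} {U : ℝ → (EuclideanSpace ℝ (Fin 3)) → (EuclideanSpace ℝ (Fin 3))} {P : ℝ → (EuclideanSpace ℝ (Fin 3)) → ℝ}
    {H : ℝ → (EuclideanSpace ℝ (Fin 3)) → (EuclideanSpace ℝ (Fin 3)) →L[ℝ] (EuclideanSpace ℝ (Fin 3))} {y' : (EuclideanSpace ℝ (Fin 3))}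
    (hδ : 0 < δ) (hδ1 : δ ≤ 1) (ha : ‖y'‖ + 2 ≤ a)
    (hsuit : IsSuitableWeakSolutionOn (parabolicCylinderOpens a (0 : ℝ × (EuclideanSpace ℝ (Fin 3)))) 1 0 U P)
    (hH : HasWeakSpatialGradientOn (parabolicCylinderOpens a (0 : ℝ × (EuclideanSpace ℝ (Fin 3)))) U H)
    (hA : ∀ r > 0, ∀ z, parabolicCylinder r z ⊆ parabolicCylinder a (0 : ℝ × (EuclideanSpace ℝ (Fin 3))) →
      cknAEss r z U ≤ ENNReal.ofReal I)
    (hE : ∀ r > 0, ∀ z, parabolicCylinder r z ⊆ parabolicCylinder a (0 : ℝ × (EuclideanSpace ℝ (Fin 3))) →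
      cknE r z H ≤ ENNReal.ofReal I)
    (hDfin : ∫⁻ w in parabolicCylinder a (0 : ℝ × (EuclideanSpace ℝ (Fin 3))), ‖P w.1 w.2‖ₑ ^ (3 / 2 : ℝ) ≠ ⊤)
    (hrate : ∀ t ∈ Ioo (-δ ^ 2) 0, ∀ x ∈ ball y' δ, Real.sqrt (-t) * ‖U t x‖ ≤ ε)
    (hε0 : 0 ≤ ε) (hε : ε ≤ epsFloor I) :
    ∃ ρ : ℝ, 0 < ρ ∧ ∃ K : ℝ,
      ∀ᵐ w ∂(volume.restrict (parabolicCylinder ρ (((0 : ℝ), y') : ℝ × (EuclideanSpace ℝ (Fin 3))))), ‖U w.1 w.2‖ ≤ K := by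
  set J := max I 1 with hJdef
  have hJ1 : 1 ≤ J := le_max_right _ _
  have hJ0 : 0 < J := by linarith
  have hθ := θ₀_pos
  have hb := b₁_pos; have hτ := τ₀_pos
  -- the two step counts
  set Dbar0 : ℝ := ((ENNReal.ofReal (δ / 2) ^ 2)⁻¹ *
      ∫⁻ w in parabolicCylinder a (0 : ℝ × (EuclideanSpace ℝ (Fin 3))), ‖P w.1 w.2‖ₑ ^ (3 / 2 : ℝ)).toReal with hDbar0
  have hD0 : 0 ≤ Dbar0 := ENNReal.toReal_nonneg
  have hbJ : 0 < b₁ * J ^ (3 / 2 : ℝ) := by positivity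
  set k₁ : ℕ := ⌈Dbar0 / (b₁ * J ^ (3 / 2 : ℝ))⌉₊ with hk₁def
  have hk₁ : Dbar0 ≤ 2 ^ k₁ * (b₁ * J ^ (3 / 2 : ℝ)) := by
    have h1 : Dbar0 / (b₁ * J ^ (3 / 2 : ℝ)) ≤ k₁ := Nat.le_ceil _
    have h2 : (k₁ : ℝ) ≤ 2 ^ k₁ := by exact_mod_cast (Nat.lt_two_pow_self).le
    rw [div_le_iff₀ hbJ] at h1
    nlinarith
  set k₂ : ℕ := ⌈(3 * b₁ * J ^ (3 / 2 : ℝ)) / (τ₀ / 3)⌉₊ with hk₂def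
  have hk₂ : 3 * b₁ * J ^ (3 / 2 : ℝ) ≤ 2 ^ k₂ * (τ₀ / 3) := by
    have h1 : (3 * b₁ * J ^ (3 / 2 : ℝ)) / (τ₀ / 3) ≤ k₂ := Nat.le_ceil _
    have h2 : (k₂ : ℝ) ≤ 2 ^ k₂ := by exact_mod_cast (Nat.lt_two_pow_self).le
    rw [div_le_iff₀ (by positivity)] at h1
    nlinarith
  set ρ : ℝ := θ₀ ^ (k₁ + 1 + k₂) * (δ / 2) with hρdef
  have hρ : 0 < ρ := by positivity
  refine ⟨ρ / 2, by positivity, C₀ * ε₀ / ρ, ?_⟩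
  -- the shifted centres `h_n ↓ 0`
  set hn : ℕ → ℝ := fun n => (δ ^ 2 / 4) / ((n : ℝ) + 1) with hndef
  have hn_pos : ∀ n, 0 < hn n := fun n => by positivity
  have hn_le : ∀ n, hn n ≤ δ ^ 2 / 4 := fun n => by
    simp only [hndef]
    rw [div_le_iff₀ (by positivity)]
    have : (0 : ℝ) ≤ n := n.cast_nonneg
    nlinarith
  have key : ∀ n, ∀ᵐ w ∂(volume.restrict (parabolicCylinder (ρ / 2) (((-hn n : ℝ), y') : ℝ × (EuclideanSpace ℝ (Fin 3))))),
      ‖U w.1 w.2‖ ≤ C₀ * ε₀ / ρ := fun n =>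
    floor_shifted hδ hδ1 ha hsuit hH hA hE hDfin hrate hε0 hε hk₁ hk₂ (hn_pos n) (hn_le n)
  -- the final-time cylinder is covered by the shifted ones
  have hcover : parabolicCylinder (ρ / 2) (((0 : ℝ), y') : ℝ × (EuclideanSpace ℝ (Fin 3))) ⊆
      ⋃ n, parabolicCylinder (ρ / 2) (((-hn n : ℝ), y') : ℝ × (EuclideanSpace ℝ (Fin 3))) := by
    intro w hw
    rw [mem_parabolicCylinder] at hw
    obtain ⟨⟨h1, h2⟩, h3⟩ := hw
    have h2' : 0 < -w.1 := by simpa using h2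
    obtain ⟨n, hN⟩ := exists_nat_gt ((δ ^ 2 / 4) / (-w.1))
    refine mem_iUnion.2 ⟨n, ?_⟩
    rw [mem_parabolicCylinder]
    have hlt : hn n < -w.1 := by
      simp only [hndef]
      rw [div_lt_iff₀ (by positivity)]
      rw [div_lt_iff₀ h2'] at hN
      nlinarith
    refine ⟨⟨?_, ?_⟩, h3⟩
    · have : (((0 : ℝ), y') : ℝ × (EuclideanSpace ℝ (Fin 3))).1 = 0 := rfl
      rw [this] at h1
      show -hn n - (ρ / 2) ^ 2 < w.1
      linarith [hn_pos n]
    · show w.1 < -hn n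
      linarith
  have hall : ∀ᵐ w ∂(volume.restrict (⋃ n, parabolicCylinder (ρ / 2) (((-hn n : ℝ), y') : ℝ × (EuclideanSpace ℝ (Fin 3))))),
      ‖U w.1 w.2‖ ≤ C₀ * ε₀ / ρ := (ae_restrict_iUnion_iff _ _).2 key
  exact ae_restrict_of_ae_restrict_of_subset hcover hall

end Summit.NavierStokesRegularity.NavierStokesRegularity.Cruxes.ScarEnvelopeTypeI.ZoomDictionary.Floor
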